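import Mathlib
import HarnessLib
import Literature.Analysis.FluidPDE.SpaceTimeRescaling

/-!
# Line `slice_budget` on crux `TypeIQuarterGate.ScarEnvelopeTypeI` (stmt-NavierStokesRegularity-23843) —
# tools for STUB B `stub_tameScarZoom`, file 2: transport of slice-wise annular cube budgets

Helper file (no new definitions).  Four measure-theoretic tools used by the twin zoom with an
octave budget (file 3, `exists_typeIAncientMild_twinZoomLimit_budget`):

* `ball_subset_annuli` — for `‖e‖ = 1`, the ball `B(e, ½)` lies in the union of the two
  e-annuli `{½ < |y| < e/2}` and `{1 < |y| < e}` about the origin (the admissible annuli of the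
  octave budget that cover the second scar);
* `space_affine_preimage_annulus`, `setLIntegral_annulus_nsZoom` — e-annuli about `x₀` pull back to
  e-annuli about `0` under `y ↦ x₀ + λ y`, and the annular cube `∫_{ℓ<|y|<eℓ} |λ u(t₀+λ²s, x₀+λy)|³ dy`
  of the Navier–Stokes zoom equals the annular cube `∫_{λℓ<|x−x₀|<eλℓ} |u(t₀+λ²s, x)|³ dx` of the
  original field (scale invariance of the slice-wise `L³` budget);
* `ae_setLIntegral_rpow_three_le_of_tendsto_eLpNorm` — FATOU ON SLICES: if `v_k → U` in
  `L³(I × S)` and every `v_k` has `∫_S |v_k(s)|³ ≤ B` at every `s ∈ I`, then `∫_S |U(s)|³ ≤ B` for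
  a.e. `s ∈ I` (an a.e.-convergent subsequence, Fubini for null sets, Fatou in `S`);
* `ae_setLIntegral_rpow_three_le_congr` — such a.e.-in-time slice bounds are invariant under a.e.
  modification of the field on `I × S`.

Bookkeeping only; no statement about the crux, its parent or the summit is proved here.
-/

noncomputable section

-- the summit-side namespace `Summit.NavierStokesRegularity.NavierStokesRegularity.…` (single-conjunct
-- summit, D-0017) repeats a component by design; the dupNamespace linter would flag every declaration.
set_option linter.dupNamespace false

namespace Summit.NavierStokesRegularity.NavierStokesRegularity.Cruxes.ScarEnvelopeTypeI.SliceBudget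

open MeasureTheory Set Function Filter Topology TopologicalSpace Metric
open scoped NNReal ENNReal
open Literature.Analysis Literature.Analysis.FluidPDE

/-! ### The two admissible annuli covering the second scar -/

/-- **`B(e, ½) ⊆ {½ < |y| < e/2} ∪ {1 < |y| < e}` for `‖e‖ = 1`**: a point of the ball has
`½ < |y| < 3/2`, and `3/2 < e`, `1 < e/2`. -/
theorem ball_subset_annuli {e : EuclideanSpace ℝ (Fin 3)} (he : ‖e‖ = 1) :
    ball e (1 / 2) ⊆
      {y : EuclideanSpace ℝ (Fin 3) | (1 / 2 : ℝ) < ‖y‖ ∧ ‖y‖ < Real.exp 1 * (1 / 2)} ∪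
        {y : EuclideanSpace ℝ (Fin 3) | (1 : ℝ) < ‖y‖ ∧ ‖y‖ < Real.exp 1 * 1} := by
  intro y hy
  rw [mem_ball, dist_eq_norm] at hy
  have hexp : (2.7182818283 : ℝ) < Real.exp 1 := Real.exp_one_gt_d9
  have h1 : (1 / 2 : ℝ) < ‖y‖ := by
    have h := norm_sub_norm_le e y
    rw [norm_sub_rev] at hy
    linarith
  have h2 : ‖y‖ < 3 / 2 := by
    have h := norm_le_norm_add_norm_sub' y e
    linarith
  by_cases hc : ‖y‖ < Real.exp 1 * (1 / 2)
  · exact Or.inl ⟨h1, hc⟩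
  · push Not at hc
    exact Or.inr ⟨by linarith, by linarith⟩

/-! ### Scale invariance of the annular cube -/

/-- The e-annulus `{λℓ < |x − x₀| < eλℓ}` about `x₀` pulls back to the e-annulus `{ℓ < |y| < eℓ}`
about the origin under `y ↦ x₀ + λ y` (`λ > 0`). -/
theorem space_affine_preimage_annulus {γ : ℝ} (hγ : 0 < γ) (x₀ : EuclideanSpace ℝ (Fin 3)) (ℓ : ℝ) :
    (fun y : EuclideanSpace ℝ (Fin 3) => x₀ + γ • y) ⁻¹'
        {x : EuclideanSpace ℝ (Fin 3) | γ * ℓ < ‖x - x₀‖ ∧ ‖x - x₀‖ < Real.exp 1 * (γ * ℓ)} =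
      {y : EuclideanSpace ℝ (Fin 3) | ℓ < ‖y‖ ∧ ‖y‖ < Real.exp 1 * ℓ} := by
  ext y
  simp only [mem_preimage, mem_setOf_eq, add_sub_cancel_left, norm_smul,
    Real.norm_of_nonneg hγ.le]
  rw [show Real.exp 1 * (γ * ℓ) = γ * (Real.exp 1 * ℓ) by ring]
  constructor
  · rintro ⟨h1, h2⟩
    exact ⟨lt_of_mul_lt_mul_left h1 hγ.le, lt_of_mul_lt_mul_left h2 hγ.le⟩
  · rintro ⟨h1, h2⟩
    exact ⟨mul_lt_mul_of_pos_left h1 hγ, mul_lt_mul_of_pos_left h2 hγ⟩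

/-- **Scale invariance of the annular cube**: for the Navier–Stokes zoom
`v(s, y) = λ u(t₀ + λ² s, x₀ + λ y)` (`λ > 0`),
`∫_{ℓ<|y|<eℓ} |v(s, y)|³ dy = ∫_{λℓ<|x−x₀|<eλℓ} |u(t₀ + λ² s, x)|³ dx`
(`λ³` from the amplitude against `λ⁻³` from the volume). -/
theorem setLIntegral_annulus_nsZoom {lam : ℝ} (hlam : 0 < lam) (t₀ : ℝ) (x₀ : EuclideanSpace ℝ (Fin 3))
    (u : ℝ → EuclideanSpace ℝ (Fin 3) → EuclideanSpace ℝ (Fin 3)) (s ℓ : ℝ) :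
    ∫⁻ y in {y : EuclideanSpace ℝ (Fin 3) | ℓ < ‖y‖ ∧ ‖y‖ < Real.exp 1 * ℓ},
        ‖(lam • stPull (lam ^ 2) lam t₀ x₀ u) s y‖ₑ ^ (3 : ℝ) =
      ∫⁻ x in {x : EuclideanSpace ℝ (Fin 3) | lam * ℓ < ‖x - x₀‖ ∧ ‖x - x₀‖ < Real.exp 1 * (lam * ℓ)},
        ‖u (t₀ + lam ^ 2 * s) x‖ₑ ^ (3 : ℝ) := by
  have e1 : ∀ y : EuclideanSpace ℝ (Fin 3), ‖(lam • stPull (lam ^ 2) lam t₀ x₀ u) s y‖ₑ ^ (3 : ℝ) =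
      ‖lam‖ₑ ^ (3 : ℝ) * ‖u (t₀ + lam ^ 2 * s) (x₀ + lam • y)‖ₑ ^ (3 : ℝ) := by
    intro y
    rw [smul_stPull_apply, enorm_smul, ENNReal.mul_rpow_of_nonneg _ _ (by norm_num)]
  simp_rw [e1]
  rw [lintegral_const_mul' _ _ (ENNReal.rpow_ne_top_of_nonneg (by norm_num) enorm_ne_top),
    ← space_affine_preimage_annulus hlam x₀ ℓ,
    setLIntegral_preimage_comp_space_affine hlam x₀
      (fun x => ‖u (t₀ + lam ^ 2 * s) x‖ₑ ^ (3 : ℝ)) _,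
    ← mul_assoc, finrank_euclideanSpace_fin]
  have hc : ‖lam‖ₑ ^ (3 : ℝ) * ENNReal.ofReal (lam ^ 3)⁻¹ = 1 := by
    rw [Real.enorm_eq_ofReal hlam.le, ENNReal.ofReal_rpow_of_nonneg hlam.le (by norm_num),
      show lam ^ (3 : ℝ) = lam ^ (3 : ℕ) by exact_mod_cast Real.rpow_natCast lam 3,
      ← ENNReal.ofReal_mul (by positivity), mul_inv_cancel₀ (by positivity), ENNReal.ofReal_one]
  rw [hc, one_mul]

/-! ### Fatou on slices under strong `L³` convergence -/

/-- **Fatou on slices.**  If `v_k → U` in `L³(I × S)` (as space–time fields) and for every `k` and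
every `s ∈ I` the slice has `∫_S |v_k(s)|³ ≤ B`, then `∫_S |U(s)|³ ≤ B` for a.e. `s ∈ I`: along a
subsequence the `v_k` converge a.e. on `I × S`, hence (Fubini for null sets) for a.e. `s` they
converge a.e. on the slice, where Fatou's lemma bounds the cube of the limit. -/
theorem ae_setLIntegral_rpow_three_le_of_tendsto_eLpNorm {I : Set ℝ} {S : Set (EuclideanSpace ℝ (Fin 3))}
    (hI : MeasurableSet I)
    {v : ℕ → ℝ → EuclideanSpace ℝ (Fin 3) → EuclideanSpace ℝ (Fin 3)}
    {U : ℝ → EuclideanSpace ℝ (Fin 3) → EuclideanSpace ℝ (Fin 3)}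
    (hv : ∀ k, AEStronglyMeasurable (uncurry (v k)) (volume.restrict (I ×ˢ S)))
    (hU : AEStronglyMeasurable (uncurry U) (volume.restrict (I ×ˢ S)))
    (hconv : Tendsto (fun k => eLpNorm (uncurry (v k) - uncurry U) 3 (volume.restrict (I ×ˢ S)))
      atTop (𝓝 0))
    {B : ℝ≥0∞} (hbound : ∀ k, ∀ s ∈ I, ∫⁻ y in S, ‖v k s y‖ₑ ^ (3 : ℝ) ≤ B) :
    ∀ᵐ s ∂(volume.restrict I), ∫⁻ y in S, ‖U s y‖ₑ ^ (3 : ℝ) ≤ B := by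
  have hμprod : (volume.restrict (I ×ˢ S) : Measure (ℝ × EuclideanSpace ℝ (Fin 3))) =
      (volume.restrict I).prod (volume.restrict S) := by
    rw [Measure.prod_restrict, ← Measure.volume_eq_prod]
  -- an a.e. convergent subsequence
  obtain ⟨φ, -, hae⟩ :=
    (tendstoInMeasure_of_tendsto_eLpNorm (by norm_num) hv hU hconv).exists_seq_tendsto_ae
  rw [hμprod] at hae
  have hae2 := Measure.ae_ae_of_ae_prod hae
  -- measurability of the slices
  have hmeas : ∀ᵐ s ∂(volume.restrict I), ∀ k,
      AEStronglyMeasurable (fun y => v k s y) (volume.restrict S) := by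
    rw [ae_all_iff]
    intro k
    have h1 := hv k
    rw [hμprod] at h1
    filter_upwards [h1.prodMk_left] with s hs
    exact hs
  filter_upwards [hae2, hmeas, ae_restrict_mem hI] with s hs hms hsI
  have hlim : ∀ᵐ y ∂(volume.restrict S),
      Tendsto (fun i => ‖v (φ i) s y‖ₑ ^ (3 : ℝ)) atTop (𝓝 (‖U s y‖ₑ ^ (3 : ℝ))) := by
    filter_upwards [hs] with y hy
    exact (ENNReal.continuous_rpow_const.tendsto _).comp hy.enorm
  calc ∫⁻ y in S, ‖U s y‖ₑ ^ (3 : ℝ)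
      = ∫⁻ y in S, liminf (fun i => ‖v (φ i) s y‖ₑ ^ (3 : ℝ)) atTop := by
        refine lintegral_congr_ae ?_
        filter_upwards [hlim] with y hy
        exact hy.liminf_eq.symm
    _ ≤ liminf (fun i => ∫⁻ y in S, ‖v (φ i) s y‖ₑ ^ (3 : ℝ)) atTop :=
        lintegral_liminf_le' fun i => ((hms (φ i)).enorm.pow_const _)
    _ ≤ B := liminf_le_of_frequently_le' (Frequently.of_forall fun i => hbound (φ i) s hsI)

/-- **Slice bounds survive a.e. modification.**  If `f = g` a.e. on `I × S` and
`∫_S |f(s)|³ ≤ B` for a.e. `s ∈ I`, then `∫_S |g(s)|³ ≤ B` for a.e. `s ∈ I` (Fubini for null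
sets). -/
theorem ae_setLIntegral_rpow_three_le_congr {I : Set ℝ} {S : Set (EuclideanSpace ℝ (Fin 3))}
    {f g : ℝ → EuclideanSpace ℝ (Fin 3) → EuclideanSpace ℝ (Fin 3)}
    (h : ∀ᵐ w ∂(volume.restrict (I ×ˢ S)), uncurry f w = uncurry g w) {B : ℝ≥0∞}
    (hf : ∀ᵐ s ∂(volume.restrict I), ∫⁻ y in S, ‖f s y‖ₑ ^ (3 : ℝ) ≤ B) :
    ∀ᵐ s ∂(volume.restrict I), ∫⁻ y in S, ‖g s y‖ₑ ^ (3 : ℝ) ≤ B := by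
  have h1 : ∀ᵐ w ∂((volume.restrict I).prod (volume.restrict S)), uncurry f w = uncurry g w := by
    rw [Measure.prod_restrict, ← Measure.volume_eq_prod]
    exact h
  filter_upwards [hf, Measure.ae_ae_of_ae_prod h1] with s hs h2
  calc ∫⁻ y in S, ‖g s y‖ₑ ^ (3 : ℝ) = ∫⁻ y in S, ‖f s y‖ₑ ^ (3 : ℝ) := by
        refine lintegral_congr_ae ?_
        filter_upwards [h2] with y hy
        change f s y = g s y at hy
        rw [hy]
    _ ≤ B := hs

/-! ### Appendix (version 2): the per-scale ball bound, and three small tools of the landed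
twin zoom (`ScarZoom`, p609629) made importable

Appended for file 3 (`exists_typeIAncientMild_twinZoomLimit_budget`); the declarations above are
unchanged. -/

/-- **The octave budget at scale `λ` bounds the cube on `B(e, ½)`.**  If `u` carries the
normalised slice-wise octave budget at `(t₀, x₀)` — `∫_{ℓ<|x−x₀|<eℓ} |u(t)|³ ≤ q` for
`t ∈ (t₀ − δ, t₀)`, `√(t₀ − t) ≤ ℓ ≤ r₀` — and `0 < λ ≤ r₀`, `λ² ≤ δ`, `‖e‖ = 1`, then the zoom
`v(s,y) = λ u(t₀ + λ²s, x₀ + λy)` has `∫_{B(e,½)} |v(s)|³ ≤ 2q` at every `s ∈ (−¼, 0)`: the two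
annuli `ℓ' = ½, 1` covering the ball are admissible (`λ√(−s) ≤ λ/2 ≤ λℓ'`, `λℓ' ≤ λ ≤ r₀`,
`t₀ − δ < t₀ + λ²s < t₀`) and the annular cube is scale invariant. -/
theorem setLIntegral_ball_nsZoom_le_of_budget
    {u : ℝ → EuclideanSpace ℝ (Fin 3) → EuclideanSpace ℝ (Fin 3)} {t₀ : ℝ}
    {x₀ e : EuclideanSpace ℝ (Fin 3)} {qb : ℝ≥0∞} {δb r₀b lam : ℝ}
    (hbudget : ∀ t ∈ Ioo (t₀ - δb) t₀, ∀ ℓ : ℝ, Real.sqrt (t₀ - t) ≤ ℓ → ℓ ≤ r₀b →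
      ∫⁻ x in {x : EuclideanSpace ℝ (Fin 3) | ℓ < ‖x - x₀‖ ∧ ‖x - x₀‖ < Real.exp 1 * ℓ},
        ‖u t x‖ₑ ^ (3 : ℝ) ≤ qb)
    (hlam : 0 < lam) (hlamr : lam ≤ r₀b) (hlamδ : lam ^ 2 ≤ δb) (he : ‖e‖ = 1)
    {s : ℝ} (hs : s ∈ Ioo (-(1 / 4 : ℝ)) 0) :
    ∫⁻ y in ball e (1 / 2), ‖(lam • stPull (lam ^ 2) lam t₀ x₀ u) s y‖ₑ ^ (3 : ℝ) ≤ 2 * qb := by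
  rw [mem_Ioo] at hs
  -- one admissible annulus
  have hann : ∀ ℓ' : ℝ, 1 / 2 ≤ ℓ' → ℓ' ≤ 1 →
      ∫⁻ y in {y : EuclideanSpace ℝ (Fin 3) | ℓ' < ‖y‖ ∧ ‖y‖ < Real.exp 1 * ℓ'},
        ‖(lam • stPull (lam ^ 2) lam t₀ x₀ u) s y‖ₑ ^ (3 : ℝ) ≤ qb := by
    intro ℓ' hℓ1 hℓ2
    have hl2 : 0 < lam ^ 2 := pow_pos hlam 2
    rw [setLIntegral_annulus_nsZoom hlam t₀ x₀ u s ℓ']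
    refine hbudget (t₀ + lam ^ 2 * s) ⟨?_, ?_⟩ (lam * ℓ') ?_ ?_
    · nlinarith [hs.1]
    · nlinarith [hs.2]
    · rw [show t₀ - (t₀ + lam ^ 2 * s) = lam ^ 2 * (-s) by ring,
        Real.sqrt_mul (sq_nonneg _), Real.sqrt_sq hlam.le]
      refine mul_le_mul_of_nonneg_left (le_trans ?_ hℓ1) hlam.le
      rw [show (1 / 2 : ℝ) = Real.sqrt ((1 / 2) ^ 2) by rw [Real.sqrt_sq (by norm_num)]]
      exact Real.sqrt_le_sqrt (by nlinarith [hs.1])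
    · calc lam * ℓ' ≤ lam * 1 := mul_le_mul_of_nonneg_left hℓ2 hlam.le
        _ ≤ r₀b := by rw [mul_one]; exact hlamr
  -- the two annuli covering the ball
  calc ∫⁻ y in ball e (1 / 2), ‖(lam • stPull (lam ^ 2) lam t₀ x₀ u) s y‖ₑ ^ (3 : ℝ)
      ≤ ∫⁻ y in {y : EuclideanSpace ℝ (Fin 3) | (1 / 2 : ℝ) < ‖y‖ ∧ ‖y‖ < Real.exp 1 * (1 / 2)} ∪
          {y : EuclideanSpace ℝ (Fin 3) | (1 : ℝ) < ‖y‖ ∧ ‖y‖ < Real.exp 1 * 1},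
          ‖(lam • stPull (lam ^ 2) lam t₀ x₀ u) s y‖ₑ ^ (3 : ℝ) :=
        lintegral_mono_set (ball_subset_annuli he)
    _ ≤ (∫⁻ y in {y : EuclideanSpace ℝ (Fin 3) | (1 / 2 : ℝ) < ‖y‖ ∧ ‖y‖ < Real.exp 1 * (1 / 2)},
          ‖(lam • stPull (lam ^ 2) lam t₀ x₀ u) s y‖ₑ ^ (3 : ℝ)) +
        ∫⁻ y in {y : EuclideanSpace ℝ (Fin 3) | (1 : ℝ) < ‖y‖ ∧ ‖y‖ < Real.exp 1 * 1},
          ‖(lam • stPull (lam ^ 2) lam t₀ x₀ u) s y‖ₑ ^ (3 : ℝ) := lintegral_union_le _ _ _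
    _ ≤ qb + qb := add_le_add (hann (1 / 2) le_rfl (by norm_num)) (hann 1 (by norm_num) le_rfl)
    _ = 2 * qb := (two_mul qb).symm

/-- **A function continuous on an open set is bounded there by its essential supremum** (Lebesgue
measure charges nonempty open sets): `‖h x‖ₑ ≤ ‖h‖_{L^∞(O)}` for `x ∈ O`.  (Public copy of the
private tool of the landed `ScarZoom` twin zoom, p609629.) -/
theorem enorm_le_eLpNorm_top_of_continuousOn {O : Set (ℝ × (EuclideanSpace ℝ (Fin 3)))}
    (hO : IsOpen O) {h : ℝ × (EuclideanSpace ℝ (Fin 3)) → EuclideanSpace ℝ (Fin 3)}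
    (hh : ContinuousOn h O) {x : ℝ × (EuclideanSpace ℝ (Fin 3))} (hx : x ∈ O) :
    ‖h x‖ₑ ≤ eLpNorm h ∞ (volume.restrict O) := by
  by_contra hlt
  push Not at hlt
  set S : ℝ≥0∞ := eLpNorm h ∞ (volume.restrict O) with hS
  have hae : ∀ᵐ y ∂(volume.restrict O), ‖h y‖ₑ ≤ S := by
    rw [hS, eLpNorm_exponent_top]
    exact enorm_ae_le_eLpNormEssSup h _
  set W : Set (ℝ × (EuclideanSpace ℝ (Fin 3))) := O ∩ (fun y => ‖h y‖ₑ) ⁻¹' Ioi S with hW_def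
  have hW : IsOpen W := (continuous_enorm.comp_continuousOn hh).isOpen_inter_preimage hO isOpen_Ioi
  have hxW : x ∈ W := ⟨hx, hlt⟩
  have hpos : 0 < volume W := hW.measure_pos volume ⟨x, hxW⟩
  have hzero : volume.restrict O W = 0 := by
    refine measure_mono_null (fun y hy => ?_) (ae_iff.1 hae)
    exact not_le.2 hy.2
  rw [Measure.restrict_apply hW.measurableSet, inter_eq_left.2 inter_subset_left] at hzero
  exact hpos.ne' hzero

/-- Every point of the open backward slab lies in some `Q(0, 2ᵐ)`.  (Public copy of the private
tool of the landed `ScarZoom` twin zoom, p609629.) -/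
theorem exists_mem_parabolicCylinder_two_pow {t : ℝ} (ht : t < 0) (x : EuclideanSpace ℝ (Fin 3)) :
    ∃ m : ℕ, ((t, x) : ℝ × (EuclideanSpace ℝ (Fin 3))) ∈
      parabolicCylinder ((2 : ℝ) ^ m) (0 : ℝ × (EuclideanSpace ℝ (Fin 3))) := by
  obtain ⟨m, hm⟩ := pow_unbounded_of_one_lt (max (-t) ‖x‖ + 1) (by norm_num : (1 : ℝ) < 2)
  refine ⟨m, ?_⟩
  have h2 : -t < (2 : ℝ) ^ m := by linarith [le_max_left (-t) ‖x‖]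
  have h3 : ‖x‖ < (2 : ℝ) ^ m := by linarith [le_max_right (-t) ‖x‖]
  rw [mem_parabolicCylinder]
  simp only [Prod.fst_zero, Prod.snd_zero, zero_sub, dist_zero_right]
  refine ⟨⟨?_, ht⟩, h3⟩
  have h1 : (1 : ℝ) ≤ (2 : ℝ) ^ m := one_le_pow₀ (by norm_num)
  nlinarith

/-- Strong `L³` convergence on a set has an a.e. convergent subsequence.  (Public copy of the
private tool of the landed `ScarZoom` twin zoom, p609629.) -/
theorem exists_subseq_tendsto_ae {Q₀ : Set (ℝ × (EuclideanSpace ℝ (Fin 3)))}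
    {v : ℕ → ℝ → (EuclideanSpace ℝ (Fin 3)) → (EuclideanSpace ℝ (Fin 3))}
    {U : ℝ → (EuclideanSpace ℝ (Fin 3)) → (EuclideanSpace ℝ (Fin 3))}
    (hv : ∀ k, AEStronglyMeasurable (uncurry (v k)) (volume.restrict Q₀))
    (hU : AEStronglyMeasurable (uncurry U) (volume.restrict Q₀))
    (hconv : Tendsto (fun k => eLpNorm (uncurry (v k) - uncurry U) 3 (volume.restrict Q₀))
      atTop (𝓝 0)) :
    ∃ φ : ℕ → ℕ, StrictMono φ ∧ ∀ᵐ w ∂(volume.restrict Q₀),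
      Tendsto (fun i => uncurry (v (φ i)) w) atTop (𝓝 (uncurry U w)) :=
  (tendstoInMeasure_of_tendsto_eLpNorm (by norm_num) hv hU hconv).exists_seq_tendsto_ae

end Summit.NavierStokesRegularity.NavierStokesRegularity.Cruxes.ScarEnvelopeTypeI.SliceBudget

end
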